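import Mathlib
import Summits.Ventures.PercRepro2.V2SP

/-!
# The path flip: recolouring a blue s–t path red moves `(r, b)` to exactly `(r+1, b−1)`, and the pairs
(configuration, blue path) at the cell `(i,b)` are in bijection with the pairs (configuration, red path) at
the cell `(i+1, b−1)` (seat mine-b, cell pub-perc-repro2; MINE-B.md §39.6)

On a series–parallel network an s–t path through free edges is: the free edge itself, a path of each factor
(series), or a path of one branch (parallel).  `bluePaths s x` is the type of blue such paths of the
configuration `x` (all edges on the path blue), `redPaths s x` the red ones; `flipB` recolours the path red.
Since both flows are minima under series and sums under parallel, the flip raises the red flow by exactly one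
and lowers the blue flow by exactly one (`rLab_flipB`, `bLab_flipB`); the flip is a bijection between
`Σ x, bluePaths s x` and `Σ x, redPaths s x` (`flipEquiv`), and restricting it to the cells gives the exact
identity `Σ_{x ∈ (i,b)} #bluePaths x = Σ_{x′ ∈ (i+1,b−1)} #redPaths x′` (`card_bluePaths_eq`) — the relay behind
the cellwise anti-diagonal unimodality of §39.6, cell by cell.  (Pins carry no path here: a pin is a unit of
both colours and flipping it does nothing — which is exactly why the cell statement fails with pins.)
-/

namespace Summit.Ventures.PercRepro2.Tail2D

open V2Closure

/-- the blue s–t paths of a configuration (free edges only; a pin or an absent edge carries none) -/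
def bluePaths : ∀ s : V2Closure.SP, s.Conf → Type
  | .free, c => Fin (if c = true then 1 else 0)
  | .pin, _ => PEmpty
  | .absent, _ => PEmpty
  | .ser s t, p => bluePaths s p.1 × bluePaths t p.2
  | .par s t, p => bluePaths s p.1 ⊕ bluePaths t p.2

/-- the red s–t paths of a configuration -/
def redPaths : ∀ s : V2Closure.SP, s.Conf → Type
  | .free, c => Fin (if c = false then 1 else 0)
  | .pin, _ => PEmpty
  | .absent, _ => PEmpty
  | .ser s t, p => redPaths s p.1 × redPaths t p.2
  | .par s t, p => redPaths s p.1 ⊕ redPaths t p.2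

/-- the configuration obtained by recolouring a blue path red -/
def flipB : ∀ (s : V2Closure.SP) (x : s.Conf), bluePaths s x → s.Conf
  | .free, _, _ => false
  | .pin, x, _ => x
  | .absent, x, _ => x
  | .ser s t, p, q => (flipB s p.1 q.1, flipB t p.2 q.2)
  | .par s _, p, .inl q => (flipB s p.1 q, p.2)
  | .par _ t, p, .inr q => (p.1, flipB t p.2 q)

/-- the configuration obtained by recolouring a red path blue -/
def flipR : ∀ (s : V2Closure.SP) (x : s.Conf), redPaths s x → s.Conf
  | .free, _, _ => true
  | .pin, x, _ => x
  | .absent, x, _ => x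
  | .ser s t, p, q => (flipR s p.1 q.1, flipR t p.2 q.2)
  | .par s _, p, .inl q => (flipR s p.1 q, p.2)
  | .par _ t, p, .inr q => (p.1, flipR t p.2 q)

/-- the flipped path, now a red path of the flipped configuration -/
def toRed : ∀ (s : V2Closure.SP) (x : s.Conf) (q : bluePaths s x), redPaths s (flipB s x q)
  | .free, true, _ => ⟨0, by simp [flipB]⟩
  | .free, false, q => Fin.elim0 q
  | .pin, _, q => q.elim
  | .absent, _, q => q.elim
  | .ser s t, p, q => (toRed s p.1 q.1, toRed t p.2 q.2)
  | .par s _, p, .inl q => Sum.inl (toRed s p.1 q)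
  | .par _ t, p, .inr q => Sum.inr (toRed t p.2 q)

/-- the flipped path, now a blue path of the flipped configuration -/
def toBlue : ∀ (s : V2Closure.SP) (x : s.Conf) (q : redPaths s x), bluePaths s (flipR s x q)
  | .free, false, _ => ⟨0, by simp [flipR]⟩
  | .free, true, q => Fin.elim0 q
  | .pin, _, q => q.elim
  | .absent, _, q => q.elim
  | .ser s t, p, q => (toBlue s p.1 q.1, toBlue t p.2 q.2)
  | .par s _, p, .inl q => Sum.inl (toBlue s p.1 q)
  | .par _ t, p, .inr q => Sum.inr (toBlue t p.2 q)

/-- **the red flow rises by exactly one** -/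
theorem rLab_flipB : ∀ (s : V2Closure.SP) (x : s.Conf) (q : bluePaths s x), s.rLab (flipB s x q) = s.rLab x + 1
  | .free, true, _ => by simp [flipB, SP.rLab]
  | .free, false, q => Fin.elim0 q
  | .pin, _, q => q.elim
  | .absent, _, q => q.elim
  | .ser s t, p, q => by
    simp only [flipB, SP.rLab, serR, rLab_flipB s p.1 q.1, rLab_flipB t p.2 q.2]; omega
  | .par s t, p, .inl q => by
    simp only [flipB, SP.rLab, parR, rLab_flipB s p.1 q]; omega
  | .par s t, p, .inr q => by
    simp only [flipB, SP.rLab, parR, rLab_flipB t p.2 q]; omega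

/-- **the blue flow falls by exactly one** -/
theorem bLab_flipB : ∀ (s : V2Closure.SP) (x : s.Conf) (q : bluePaths s x), s.bLab (flipB s x q) + 1 = s.bLab x
  | .free, true, _ => by simp [flipB, SP.bLab]
  | .free, false, q => Fin.elim0 q
  | .pin, _, q => q.elim
  | .absent, _, q => q.elim
  | .ser s t, p, q => by
    have h1 := bLab_flipB s p.1 q.1
    have h2 := bLab_flipB t p.2 q.2
    simp only [flipB, SP.bLab, serB]; omega
  | .par s t, p, .inl q => by
    have h1 := bLab_flipB s p.1 q
    simp only [flipB, SP.bLab, parB]; omega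
  | .par s t, p, .inr q => by
    have h1 := bLab_flipB t p.2 q
    simp only [flipB, SP.bLab, parB]; omega

/-- flipping back recovers the configuration -/
theorem flipR_flipB : ∀ (s : V2Closure.SP) (x : s.Conf) (q : bluePaths s x), flipR s (flipB s x q) (toRed s x q) = x
  | .free, true, _ => rfl
  | .free, false, q => Fin.elim0 q
  | .pin, _, q => q.elim
  | .absent, _, q => q.elim
  | .ser s t, p, q => by
    simp only [flipB, flipR, toRed, flipR_flipB s p.1 q.1, flipR_flipB t p.2 q.2]
    exact Prod.mk.eta
  | .par s t, p, .inl q => by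
    simp only [flipB, flipR, toRed, flipR_flipB s p.1 q]
    exact Prod.mk.eta
  | .par s t, p, .inr q => by
    simp only [flipB, flipR, toRed, flipR_flipB t p.2 q]
    exact Prod.mk.eta

/-- flipping back recovers the configuration (red to blue to red) -/
theorem flipB_flipR : ∀ (s : V2Closure.SP) (x : s.Conf) (q : redPaths s x), flipB s (flipR s x q) (toBlue s x q) = x
  | .free, false, _ => rfl
  | .free, true, q => Fin.elim0 q
  | .pin, _, q => q.elim
  | .absent, _, q => q.elim
  | .ser s t, p, q => by
    simp only [flipB, flipR, toBlue, flipB_flipR s p.1 q.1, flipB_flipR t p.2 q.2]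
    exact Prod.mk.eta
  | .par s t, p, .inl q => by
    simp only [flipB, flipR, toBlue, flipB_flipR s p.1 q]
    exact Prod.mk.eta
  | .par s t, p, .inr q => by
    simp only [flipB, flipR, toBlue, flipB_flipR t p.2 q]
    exact Prod.mk.eta

/-- the paths of a configuration are finitely many -/
@[reducible] def bluePathsFintype : ∀ (s : V2Closure.SP) (x : s.Conf), Fintype (bluePaths s x)
  | .free, c => inferInstanceAs (Fintype (Fin (if c = true then 1 else 0)))
  | .pin, _ => inferInstanceAs (Fintype PEmpty)
  | .absent, _ => inferInstanceAs (Fintype PEmpty)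
  | .ser s t, p =>
      let _ := bluePathsFintype s p.1
      let _ := bluePathsFintype t p.2
      inferInstanceAs (Fintype (bluePaths s p.1 × bluePaths t p.2))
  | .par s t, p =>
      let _ := bluePathsFintype s p.1
      let _ := bluePathsFintype t p.2
      inferInstanceAs (Fintype (bluePaths s p.1 ⊕ bluePaths t p.2))

/-- the red paths of a configuration are finitely many -/
@[reducible] def redPathsFintype : ∀ (s : V2Closure.SP) (x : s.Conf), Fintype (redPaths s x)
  | .free, c => inferInstanceAs (Fintype (Fin (if c = false then 1 else 0)))
  | .pin, _ => inferInstanceAs (Fintype PEmpty)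
  | .absent, _ => inferInstanceAs (Fintype PEmpty)
  | .ser s t, p =>
      let _ := redPathsFintype s p.1
      let _ := redPathsFintype t p.2
      inferInstanceAs (Fintype (redPaths s p.1 × redPaths t p.2))
  | .par s t, p =>
      let _ := redPathsFintype s p.1
      let _ := redPathsFintype t p.2
      inferInstanceAs (Fintype (redPaths s p.1 ⊕ redPaths t p.2))

/-- finiteness of the blue paths, as an instance -/
instance (s : V2Closure.SP) (x : s.Conf) : Fintype (bluePaths s x) := bluePathsFintype s x

/-- finiteness of the red paths, as an instance -/
instance (s : V2Closure.SP) (x : s.Conf) : Fintype (redPaths s x) := redPathsFintype s x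

/-- a pair of heterogeneous equalities gives one for the pairs -/
theorem heq_prod_mk {α α' β β' : Type} {a : α} {a' : α'} {b : β} {b' : β'} (h : HEq a a') (h' : HEq b b') :
    HEq (a, b) (a', b') := by
  cases h; cases h'; rfl

/-- a heterogeneous equality of left summands -/
theorem heq_sum_inl {α α' β : Type} {a : α} {a' : α'} (h : HEq a a') :
    HEq (Sum.inl a : α ⊕ β) (Sum.inl a' : α' ⊕ β) := by
  cases h; rfl

/-- a heterogeneous equality of right summands -/
theorem heq_sum_inr {α β β' : Type} {b : β} {b' : β'} (h : HEq b b') :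
    HEq (Sum.inr b : α ⊕ β) (Sum.inr b' : α ⊕ β') := by
  cases h; rfl

/-- flipping a blue path red and back gives the path itself -/
theorem toBlue_toRed : ∀ (s : V2Closure.SP) (x : s.Conf) (q : bluePaths s x),
    HEq (toBlue s (flipB s x q) (toRed s x q)) q
  | .free, true, q => by
    exact heq_of_eq (Subsingleton.elim (α := Fin 1) (toBlue .free (flipB .free true q) (toRed .free true q)) q)
  | .free, false, q => Fin.elim0 q
  | .pin, _, q => q.elim
  | .absent, _, q => q.elim
  | .ser s t, p, q => by
    simp only [toBlue, toRed, flipB, flipR]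
    exact heq_prod_mk (toBlue_toRed s p.1 q.1) (toBlue_toRed t p.2 q.2)
  | .par s t, p, .inl q => by
    simp only [toBlue, toRed, flipB, flipR]
    exact heq_sum_inl (toBlue_toRed s p.1 q)
  | .par s t, p, .inr q => by
    simp only [toBlue, toRed, flipB, flipR]
    exact heq_sum_inr (toBlue_toRed t p.2 q)

/-- flipping a red path blue and back gives the path itself -/
theorem toRed_toBlue : ∀ (s : V2Closure.SP) (x : s.Conf) (q : redPaths s x),
    HEq (toRed s (flipR s x q) (toBlue s x q)) q
  | .free, false, q => by
    exact heq_of_eq (Subsingleton.elim (α := Fin 1) (toRed .free (flipR .free false q) (toBlue .free false q)) q)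
  | .free, true, q => Fin.elim0 q
  | .pin, _, q => q.elim
  | .absent, _, q => q.elim
  | .ser s t, p, q => by
    simp only [toBlue, toRed, flipB, flipR]
    exact heq_prod_mk (toRed_toBlue s p.1 q.1) (toRed_toBlue t p.2 q.2)
  | .par s t, p, .inl q => by
    simp only [toBlue, toRed, flipB, flipR]
    exact heq_sum_inl (toRed_toBlue s p.1 q)
  | .par s t, p, .inr q => by
    simp only [toBlue, toRed, flipB, flipR]
    exact heq_sum_inr (toRed_toBlue t p.2 q)

/-- **the flip is a bijection between the pairs (configuration, blue path) and the pairs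
(configuration, red path)** -/
def flipEquiv (s : V2Closure.SP) : (Σ x : s.Conf, bluePaths s x) ≃ (Σ x : s.Conf, redPaths s x) where
  toFun y := ⟨flipB s y.1 y.2, toRed s y.1 y.2⟩
  invFun y := ⟨flipR s y.1 y.2, toBlue s y.1 y.2⟩
  left_inv y := Sigma.ext (flipR_flipB s y.1 y.2) (toBlue_toRed s y.1 y.2)
  right_inv y := Sigma.ext (flipB_flipR s y.1 y.2) (toRed_toBlue s y.1 y.2)

/-- **the cell identity**: the pairs (configuration, blue path) at the cell `(i,b)` are as many as the pairs
(configuration, red path) at the cell `(i+1, b−1)`, for every pattern and every `b ≥ 1` -/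
theorem card_bluePaths_eq (s : V2Closure.SP) (i b : ℕ) (hb : 1 ≤ b) :
    ∑ x ∈ Finset.univ.filter (fun x : s.Conf => s.rLab x = i ∧ s.bLab x = b), Fintype.card (bluePaths s x)
      = ∑ x ∈ Finset.univ.filter (fun x : s.Conf => s.rLab x = i + 1 ∧ s.bLab x = b - 1),
          Fintype.card (redPaths s x) := by
  rw [Finset.sum_subtype (Finset.univ.filter (fun x : s.Conf => s.rLab x = i ∧ s.bLab x = b))
      (p := fun x : s.Conf => s.rLab x = i ∧ s.bLab x = b) (fun x => by simp),
    Finset.sum_subtype (Finset.univ.filter (fun x : s.Conf => s.rLab x = i + 1 ∧ s.bLab x = b - 1))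
      (p := fun x : s.Conf => s.rLab x = i + 1 ∧ s.bLab x = b - 1) (fun x => by simp),
    ← Fintype.card_sigma, ← Fintype.card_sigma]
  refine Fintype.card_congr ?_
  refine (Equiv.subtypeSigmaEquiv _ _).symm.trans ?_
  refine Equiv.trans ?_ (Equiv.subtypeSigmaEquiv _ _)
  refine Equiv.subtypeEquiv (flipEquiv s) (fun y => ?_)
  simp only [flipEquiv, Equiv.coe_fn_mk]
  rw [rLab_flipB, ← bLab_flipB s y.1 y.2]
  omega

end Summit.Ventures.PercRepro2.Tail2D
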